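import Mathlib
import Summits.ResolutionOfSingularities.ResolutionOfSingularities.Theorems.WeightedInvariantLocalWeightedDropWildMonicFlagN0Transport

/-!
# `WeightedInvariant.LocalWeightedDrop`, line `hasse-ridge-face-selection`, S3ρ sub-stub S3ρD `stub_wildMonicSurfaceDescent`: item D-0
# «maximising flag» — THE COMPANION READING `sComp` IS A MONOTONE FUNCTION OF `sFlag` ON A SETTING CLASS (point sets)

Crux item stmt-ResolutionOfSingularities-8899 `LocalWeightedDrop` (route `ResolutionOfSingularities/WeightedInvariant`), engine of the door
`HypersurfaceCentreConstruction` stmt-ResolutionOfSingularities-19897.  [OURS · L1 W4.3, chain w43, res-L1-w43-stub-3 (gen 4) on roadmap item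
D-0 of `L/res-L1-w43-stub-7/S3RHOD-ROADMAP.md` (owners res-type-083 / stub-7); spec `L/res-L1-w43-stub-3/D0-SPEC.md` §8 — the «sComp
analogue» owed by the bridge `…WildMonicFlagAttainBridge` (split with res-D-pv-056 AS stub-5, STATUS 2026-08-27T09:15:07Z).  MODEL:
S. Perlega, thesis Wien 2017 / arXiv:2011.14443, Lemma `coeff_ideal_of_powers` as used in the proof of Prop. 7.4.5 (3) (chunk p0093
L20–L30: for `0 < d < c!`, `s_𝓖 = min {((d(c!−d))!/d!)·ord coeff^d(I₂), ((d(c!−d))!/(c!−d)!)·ord coeff^{c!−d}(M₂)}` and «since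
`M_{2,𝐱} = M_{2,𝐱₁}` holds, this proves `s_𝓖 ≤ s_𝓕`»), read on stub-7's point-set numbers `coeffOrd / sFlag / compSet / sComp / sValue`
of `…WildMonicFlagDefs` (p500044).  Nothing here is a statement of H. Hironaka's manuscript; every object is OURS; AI-written,
gate-accepted means sorry-free with standard axioms, not refereed.  Definition-free.]

* `coeffOrd_insert` — one more point: the minimum with the new point's term.
* `factorial_div_mul_smul`, **`coeffOrd_image_smul`** — DILATION LAW `coeffOrd (D·m) (m • S) = ((D·m)!/D!) · coeffOrd D S`
  (`ord coeff^{Dm}(I^m) = ((Dm)!/D!) · ord coeff^D(I)` on exponents; all divisions exact).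
* **`sComp_eq_min`** — `sComp L E N = min (coeffOrd (D(L−D)) {D • r}) (((D(L−D))!/D!) · sFlag E N)` for `D = dRes E N < L`,
  `r = excExp E N`: the companion reading is the minimum of a term depending on the SETTING `(D, r)` only and a positive multiple of `sFlag`.
* **`sValue_le_sValue_of_sFlag_le`** — on a setting class (`dRes`, `excExp` fixed, `dRes > 0`) `sValue L` is monotone in `sFlag`;
  `sValue_ne_top_of_sFlag_ne_top` — and finite when `sFlag` is.  CONSEQUENCE for D-0: every attainment / semicontinuity statement
  proved for `sFlag` on a setting class (Per17 Ch. 5, where `s = ord coeff^d(I₋₁)` in all cases) transfers verbatim to the flag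
  invariant's `s`-entry `sValue d!` with its three-way split (HP24 p. 803).
* `sFlag_ne_top_of_one_mem` — `1 ∈ E`, `N ≠ ∅`, `dRes > 0` ⇒ `sFlag E N ≠ ⊤` (the point realising `r₁ = epsL N` reduces onto the row
  `0 < D`): for coordinate classes the exit «`s = ∞`» of Per17 Lemma 7.4.11 never occurs.
-/

set_option linter.dupNamespace false -- mandated namespace of this single-conjunct summit

namespace Summit.ResolutionOfSingularities.ResolutionOfSingularities.Theorems

namespace WildMonic

open MonicDescent

/-! ## §1 Point sets: the companion reading as a monotone function of `sFlag` -/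

section PointSets

variable {S N N' : Set (Fin 2 →₀ ℕ)}

/-- `coeffOrd` of a set with one more point: the minimum of the new point's term (`⊤` if it lies on or above the row `δ`) and the old
value. -/
theorem coeffOrd_insert (δ : ℕ) (P : Fin 2 →₀ ℕ) (S : Set (Fin 2 →₀ ℕ)) :
    coeffOrd δ (insert P S) = min (coeffOrd δ {P}) (coeffOrd δ S) := by
  apply le_antisymm
  · refine le_min ?_ ?_
    · rw [le_coeffOrd_iff]
      intro Q hQ hQ1
      rw [Set.mem_singleton_iff] at hQ
      subst hQ
      exact coeffOrd_le (Set.mem_insert _ _) hQ1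
    · rw [le_coeffOrd_iff]
      intro Q hQ hQ1
      exact coeffOrd_le (Set.mem_insert_of_mem _ hQ) hQ1
  · rw [le_coeffOrd_iff]
    intro Q hQ hQ1
    rcases (Set.mem_insert_iff).1 hQ with rfl | hQS
    · exact (min_le_left _ _).trans (coeffOrd_le (Set.mem_singleton _) hQ1)
    · exact (min_le_right _ _).trans (coeffOrd_le hQS hQ1)

/-- The term of a dilated point at the dilated level: `((D·m)!/(D·m − m·Q₁)) · (m·Q₀) = ((D·m)!/D!) · ((D!/(D − Q₁)) · Q₀)` for
`Q₁ < D`, `0 < m` (all divisions exact). -/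
theorem factorial_div_mul_smul {D m : ℕ} (hm : 0 < m) {Q : Fin 2 →₀ ℕ} (hQ : Q 1 < D) :
    (D * m).factorial / (D * m - (m • Q) 1) * ((m • Q) 0) = (D * m).factorial / D.factorial * (D.factorial / (D - Q 1) * Q 0) := by
  simp only [Finsupp.smul_apply, smul_eq_mul]
  have hb : 0 < D - Q 1 := Nat.sub_pos_of_lt hQ
  have hDm : D ≤ D * m := Nat.le_mul_of_pos_right _ hm
  obtain ⟨u, hu⟩ : (D - Q 1) ∣ D.factorial := Nat.dvd_factorial hb (Nat.sub_le _ _)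
  obtain ⟨v, hv⟩ : D.factorial ∣ (D * m).factorial := Nat.factorial_dvd_factorial hDm
  have hmb : 0 < m * (D - Q 1) := Nat.mul_pos hm hb
  obtain ⟨t, ht⟩ : m * (D - Q 1) ∣ (D * m).factorial :=
    Nat.dvd_factorial hmb (by rw [mul_comm D m]; exact Nat.mul_le_mul_left _ (Nat.sub_le _ _))
  have hsub : D * m - m * Q 1 = m * (D - Q 1) := by rw [Nat.mul_sub, mul_comm m D]
  have huv : u * v = m * t := by
    apply Nat.eq_of_mul_eq_mul_left hb
    calc (D - Q 1) * (u * v) = D.factorial * v := by rw [hu]; ring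
      _ = (D * m).factorial := hv.symm
      _ = (D - Q 1) * (m * t) := by rw [ht]; ring
  have h1 : (D * m).factorial / (m * (D - Q 1)) = t := by rw [ht, Nat.mul_div_cancel_left _ hmb]
  have h2 : (D * m).factorial / D.factorial = v := by rw [hv, Nat.mul_div_cancel_left _ (Nat.factorial_pos D)]
  have h3 : D.factorial / (D - Q 1) = u := by rw [hu, Nat.mul_div_cancel_left _ hb]
  rw [hsub, h1, h2, h3]
  calc t * (m * Q 0) = (m * t) * Q 0 := by ring
    _ = (u * v) * Q 0 := by rw [huv]
    _ = v * (u * Q 0) := by ring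

/-- **DILATION LAW**: the coefficient-ideal order of the `m`-fold dilation at the `m`-fold level is `(D·m)!/D!` times the order at
level `D` (`ord coeff^{D·m}(I^m) = ((Dm)!/D!)·ord coeff^D(I)` on exponents). [cite: Perlega2020, Lemma `coeff_ideal_of_powers`
(arXiv:2011.14443 chunk p0093 L25)] -/
theorem coeffOrd_image_smul {D m : ℕ} (hm : 0 < m) (S : Set (Fin 2 →₀ ℕ)) :
    coeffOrd (D * m) ((fun P => m • P) '' S) = (((D * m).factorial / D.factorial : ℕ) : ℕ∞) * coeffOrd D S := by
  have hc : (((D * m).factorial / D.factorial : ℕ) : ℕ∞) ≠ 0 := by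
    have : 0 < (D * m).factorial / D.factorial :=
      Nat.div_pos (Nat.le_of_dvd (Nat.factorial_pos _) (Nat.factorial_dvd_factorial (Nat.le_mul_of_pos_right _ hm)))
        (Nat.factorial_pos D)
    exact_mod_cast this.ne'
  have hlt : ∀ Q : Fin 2 →₀ ℕ, (m • Q) 1 < D * m ↔ Q 1 < D := by
    intro Q
    simp only [Finsupp.smul_apply, smul_eq_mul]
    rw [mul_comm D m]
    exact Nat.mul_lt_mul_left hm
  apply le_antisymm
  · -- `≤`: every point of `S` below the row `D` gives a dilated point below the row `D·m`
    unfold coeffOrd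
    rw [ENat.mul_iInf_of_ne hc]
    refine le_iInf fun Q => ?_
    rw [ENat.mul_iInf_of_ne hc]
    refine le_iInf fun hQ => ?_
    obtain ⟨hQS, hQ1⟩ := hQ
    have h := iInf₂_le (f := fun (P : Fin 2 →₀ ℕ) (_ : P ∈ {P : Fin 2 →₀ ℕ | P ∈ (fun P => m • P) '' S ∧ P 1 < D * m}) =>
      (((D * m).factorial / (D * m - P 1) * P 0 : ℕ) : ℕ∞)) (m • Q) ⟨⟨Q, hQS, rfl⟩, (hlt Q).2 hQ1⟩
    refine h.trans (le_of_eq ?_)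
    rw [factorial_div_mul_smul hm hQ1, Nat.cast_mul]
  · rw [le_coeffOrd_iff]
    rintro P ⟨Q, hQS, rfl⟩ hP1
    have hQ1 : Q 1 < D := (hlt Q).1 hP1
    rw [factorial_div_mul_smul hm hQ1, Nat.cast_mul]
    gcongr
    exact coeffOrd_le hQS hQ1

/-- **THE COMPANION READING IS `min (corner, scaled sFlag)`** [Perlega's `coeff_ideal_of_powers` on exponents]: for
`0 < D = dRes E N < L`, `sComp L E N = min (coeffOrd (D(L−D)) {D • r}) (((D(L−D))!/D!) · sFlag E N)`, `r = excExp E N` — the first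
term depends on the setting `(D, r)` only. [cite: Perlega2020, Prop. 7.4.5 (3) proof, Lemma `coeff_ideal_of_powers`
(arXiv:2011.14443 chunk p0093 L1–L30)] -/
theorem sComp_eq_min (L : ℕ) (E : Finset (Fin 2)) (N : Set (Fin 2 →₀ ℕ)) (hL : dRes E N < L) :
    sComp L E N = min (coeffOrd (dRes E N * (L - dRes E N)) {dRes E N • excExp E N})
      ((((dRes E N * (L - dRes E N)).factorial / (dRes E N).factorial : ℕ) : ℕ∞) * sFlag E N) := by
  unfold sComp compSet sFlag
  rw [coeffOrd_insert]
  congr 1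
  -- `deltaL (reduce r N) = dRes E N` by definition
  show coeffOrd (dRes E N * (L - dRes E N)) ((fun P => (L - dRes E N) • P) '' reduce (excExp E N) N) = _
  exact coeffOrd_image_smul (Nat.sub_pos_of_lt hL) _

/-- **`sValue` IS MONOTONE IN `sFlag` ON A SETTING CLASS**: two point sets with the same setting `(dRes, excExp) = (D, r)`, `D > 0`,
compare in `sValue L` as they compare in `sFlag` (case `D ≥ L`: `sValue = sFlag`; case `0 < D < L`: `sComp_eq_min`). -/
theorem sValue_le_sValue_of_sFlag_le (L : ℕ) (E : Finset (Fin 2)) (hD : dRes E N = dRes E N') (hr : excExp E N = excExp E N')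
    (hpos : 0 < dRes E N) (h : sFlag E N ≤ sFlag E N') : sValue L E N ≤ sValue L E N' := by
  by_cases hLD : L ≤ dRes E N
  · rw [sValue_of_le hLD, sValue_of_le (hD ▸ hLD)]
    exact h
  · have hlt : dRes E N < L := not_le.mp hLD
    rw [sValue_of_lt hlt hpos, sValue_of_lt (hD ▸ hlt) (hD ▸ hpos), sComp_eq_min L E N hlt, sComp_eq_min L E N' (hD ▸ hlt),
      ← hD, ← hr]
    exact min_le_min le_rfl (by gcongr)

/-- On a setting class with `D > 0`, `sValue` is finite as soon as `sFlag` is. -/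
theorem sValue_ne_top_of_sFlag_ne_top (L : ℕ) (E : Finset (Fin 2)) (hpos : 0 < dRes E N) (h : sFlag E N ≠ ⊤) :
    sValue L E N ≠ ⊤ := by
  by_cases hLD : L ≤ dRes E N
  · rwa [sValue_of_le hLD]
  · have hlt : dRes E N < L := not_le.mp hLD
    rw [sValue_of_lt hlt hpos, sComp_eq_min L E N hlt]
    refine ne_top_of_le_ne_top ?_ (min_le_right _ _)
    exact WithTop.mul_ne_top (WithTop.coe_ne_top) h

/-- **`1 ∈ E`, `D > 0` ⇒ `sFlag ≠ ⊤`**: the point of `N` realising `r₁ = epsL N` reduces to a point ON THE ROW `0 < D` of the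
reduced set, so the coefficient ideal `coeff^D(I₂)` is not zero.  (For the coordinate classes of D-0 the exit «`s = ∞`» of Per17
Lemma 7.4.11 therefore never occurs.) -/
theorem sFlag_ne_top_of_one_mem {E : Finset (Fin 2)} (h1 : (1 : Fin 2) ∈ E) (hN : N.Nonempty) (hpos : 0 < dRes E N) :
    sFlag E N ≠ ⊤ := by
  obtain ⟨P, hP, hP1⟩ := exists_eq_epsL hN
  have hr1 : excExp E N 1 = P 1 := by rw [excExp_apply_one, if_pos h1, hP1]
  have hmem : P - excExp E N ∈ reduce (excExp E N) N := ⟨P, hP, rfl⟩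
  have hrow : (P - excExp E N) 1 < dRes E N := by
    simp only [Finsupp.tsub_apply, hr1, Nat.sub_self]
    exact hpos
  intro htop
  have hle := coeffOrd_le (S := reduce (excExp E N) N) hmem hrow
  unfold sFlag at htop
  rw [htop, top_le_iff] at hle
  exact ENat.coe_ne_top _ hle

end PointSets

end WildMonic

end Summit.ResolutionOfSingularities.ResolutionOfSingularities.Theorems
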